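import Summits.HodgeConjecture.HodgeConjecture.Theorems.F0P3cStCharTSStrictDerivNewton   -- ★ p851993 (this seat) FILE 2: §0 translation lemmas; brings ★ C1a∕C1b and ★ D1
import HarnessLib

/-!
# F0 · P3c · ROAD «HC-D» (holder F0P2-p01) — FILE 2′ «NEWTON CORE»: the chart package from NEWTON DATA ALONE (no scalar field), and DESCENT of Newton data to a
# closed additive subgroup (the unitary `F`-form `𝔲 ⊂ M₃(K)` is NOT a `K`-subspace — calculus is done over `K` on the ambient space, then descended here)

Cell `pub/hodgecm-mathlib`, crux H413 = `stmt-HodgeConjecture-24833` (lane `--supports … --as helper`), route HCCMUnconditional; ROAD «HC-D».  THEOREMS ONLY; ★-only imports.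
HONEST LABEL: HC_CM is proved only modulo the 7 printed citations (2 remaining named inputs: hLiu418 = `stmt-HodgeConjecture-24832`, h413 = `stmt-HodgeConjecture-24833`)
until rung 0 closes; count-neutral.

WHY.  ★ FILE 2 `exists_depth_chart` starts from `HasStrictFDerivAt φ e x₀` over a normed field `𝕜` acting on `V`.  The road's carriers — the skew-hermitian `F`-form
`𝔲 = {X ∈ M₃(K) : (X.map σ)ᵀ J + J X = 0}` and its slices — are additive subgroups of `K`-spaces that are NOT `K`-subspaces, and the tree carries no normed `F`-module
structure on them (`F = K^σ`).  The cure is the pipeline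
  (1) `HasStrictFDerivAt` over `K` on the AMBIENT `K`-space (or on `K`-subspaces `C₁ × C₂`, as ★ `SemisimpleOrbitChartUnitary`) ⟹ ★ D1 `exists_depth_linearNewton_of_hasStrictFDerivAt`:
      NORM-PHRASED NEWTON DATA `∀ k ≥ k₀, ∀ j ≥ k, ‖x‖ ≤ rγᵏ → ‖y‖ ≤ rγʲ → φ (x₀+(x+y)) − φ (x₀+x) − L y ∈ L '' closedBall 0 (rγ^{j+1})`;
  (2) §2 `newtonData_addSubgroup`: if `φ (x₀ + ·) − φ x₀` maps the subgroup `S` into `S'` and `L` restricts to `LS : S ≃ₜ+ S'`, the SAME data holds for the restricted map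
      `S → S'` (subtype norms) — pure bookkeeping, because `L z ∈ S'` forces `z ∈ S`;
  (3) §1 `depth_chart_of_newtonData`: on any ultrametric proper normed additive group `V` with Haar `μ`, Newton data ALONE (for `L : V ≃ₜ+ W`) gives the package of ★ FILE 2:
      injectivity on the box, `φ '' (x₀ + x +ᵥ Λ j) = φ (x₀ + x) +ᵥ L '' Λ j`, `(μ|Λk).map (v ↦ φ (x₀+v) − φ x₀) = (μ|Λk).map L`, and
      `∫⁻ v in Λ k, f (φ (x₀ + v)) ∂μ = ∫⁻ v in Λ k, f (φ x₀ + L v) ∂μ`.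
So the D5∕D6 slice hands (descent slice at type `(a,a,b)`, Slodowy slice at `N_min`, Cayley chart `S(X₀,·)`) never need an `F`-vector-space structure on `𝔲`.

## References
* [Schikhof1984] W. H. Schikhof, *Ultrametric Calculus* (1984), §27 Lemma 27.4–Thm. 27.5.
* [Serre1992LALG] J.-P. Serre, *Lie Algebras and Lie Groups*, LNM 1500 (1992), Part II Ch. IV §9.
-/

set_option autoImplicit false
-- the mandated namespace has the single-problem summit's repeated segment (`HodgeConjecture.HodgeConjecture`)
set_option linter.dupNamespace false

noncomputable section

open MeasureTheory Filter Metric Set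
open scoped Topology Pointwise ENNReal
open Literature.Analysis.Calculus
open Summit.HodgeConjecture.HodgeConjecture.Cruxes.H413.F0P3cStCharTSFilteredNewton
open Summit.HodgeConjecture.HodgeConjecture.Cruxes.H413.F0P3cStCharTSFilteredNewtonHaar
open Summit.HodgeConjecture.HodgeConjecture.Cruxes.H413.F0P3cStCharTSStrictDerivNewton

namespace Summit.HodgeConjecture.HodgeConjecture.Cruxes.H413.F0P3cStCharTSNewtonCore

/-! ## §1 The chart package from Newton data alone (no scalar field) -/

section Core

variable {V : Type*} [NormedAddCommGroup V] [IsUltrametricDist V] [ProperSpace V] [MeasurableSpace V] [BorelSpace V]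
  {W : Type*} [NormedAddCommGroup W] [MeasurableSpace W] [BorelSpace W]
  (μ : Measure V) [IsFiniteMeasureOnCompacts μ] [μ.IsAddLeftInvariant]

/-- **Chart package from NEWTON DATA.**  `V` an ultrametric proper normed additive group with a left-invariant Borel measure finite on compacts, `W` a normed additive group,
`L : V ≃ₜ+ W`, `φ : V → W`, `x₀ : V`, `Λ j = closedBall 0 (rγʲ)`.  If for all `k ≥ k₀`, `j ≥ k`, `‖x‖ ≤ rγᵏ`, `‖y‖ ≤ rγʲ` one has
`φ (x₀ + (x + y)) − φ (x₀ + x) − L y ∈ L '' closedBall 0 (rγ^{j+1})`, then for all `k ≥ k₀`: (a) `φ` is injective on `x₀ +ᵥ Λ k`; (b) `φ '' (x₀ + x +ᵥ Λ j) = φ (x₀ + x) +ᵥ L '' Λ j`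
(`j ≥ k`, `x ∈ Λ k`); (c) `(μ|Λk).map (v ↦ φ (x₀+v) − φ x₀) = (μ|Λk).map L`; (d) `∫⁻ v in Λ k, f (φ (x₀ + v)) ∂μ = ∫⁻ v in Λ k, f (φ x₀ + L v) ∂μ` for measurable `f`.
[cite: Schikhof1984, §27 Lemma 27.4–Thm. 27.5] [cite: Serre1992LALG, Part II Ch. IV §9] -/
theorem depth_chart_of_newtonData {φ : V → W} {x₀ : V} (L : V ≃ₜ+ W)
    {Λ : ℕ → AddSubgroup V} {r γ : ℝ} (hΛ : ∀ j, (Λ j : Set V) = closedBall (0 : V) (r * γ ^ j)) (hr : 0 < r) (hγ0 : 0 < γ) (hγ1 : γ < 1)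
    {k₀ : ℕ} (hN : ∀ k, k₀ ≤ k → ∀ j, k ≤ j → ∀ x ∈ closedBall (0 : V) (r * γ ^ k), ∀ y ∈ closedBall (0 : V) (r * γ ^ j),
      φ (x₀ + (x + y)) - φ (x₀ + x) - L y ∈ (L : V → W) '' closedBall (0 : V) (r * γ ^ (j + 1))) :
    ∀ k, k₀ ≤ k →
      InjOn φ (x₀ +ᵥ (Λ k : Set V)) ∧
      (∀ j, k ≤ j → ∀ x ∈ Λ k, φ '' ((x₀ + x) +ᵥ (Λ j : Set V)) = φ (x₀ + x) +ᵥ (L : V → W) '' (Λ j : Set V)) ∧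
      (μ.restrict (Λ k : Set V)).map (fun v => φ (x₀ + v) - φ x₀) = (μ.restrict (Λ k : Set V)).map L ∧
      (∀ f : W → ℝ≥0∞, Measurable f → ∫⁻ v in (Λ k : Set V), f (φ (x₀ + v)) ∂μ = ∫⁻ v in (Λ k : Set V), f (φ x₀ + L v) ∂μ) := by
  have hanti : Antitone Λ := antitone_of_coe_eq_closedBall hΛ hr.le hγ0.le hγ1.le
  have hopen : ∀ j, IsOpen (Λ j : Set V) := isOpen_of_coe_eq_closedBall hΛ hr hγ0
  have hbasis : ∀ U ∈ 𝓝 (0 : V), ∃ j, (Λ j : Set V) ⊆ U := exists_subset_of_mem_nhds_of_coe_eq_closedBall hΛ hr hγ1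
  have hcomp : ∀ j, IsCompact (Λ j : Set V) := isCompact_of_coe_eq_closedBall hΛ
  intro k hk
  set φ₀ : V → W := fun v => φ (x₀ + v) - φ x₀ with hφ₀
  -- the subgroup-phrased Newton hypothesis for `φ₀`
  have hNΛ : ∀ j, k ≤ j → ∀ x ∈ Λ k, ∀ y ∈ Λ j, φ₀ (x + y) - φ₀ x - L y ∈ (L : V → W) '' (Λ (j + 1) : Set V) := by
    intro j hj x hx y hy
    have hx' : x ∈ closedBall (0 : V) (r * γ ^ k) := by rw [← hΛ]; exact hx
    have hy' : y ∈ closedBall (0 : V) (r * γ ^ j) := by rw [← hΛ]; exact hy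
    obtain ⟨z, hz, hzeq⟩ := hN k hk j hj x hx' y hy'
    refine ⟨z, by rw [hΛ]; exact hz, ?_⟩
    simp only [hφ₀, hzeq]
    abel
  have hcont : ContinuousOn φ₀ (Λ k : Set V) := continuousOn_of_linearNewton Λ φ₀ L hanti hopen hbasis hNΛ
  have h0 : L.symm (φ₀ 0) ∈ Λ k := by
    have : φ₀ 0 = 0 := by simp [hφ₀]
    rw [this, map_zero]; exact (Λ k).zero_mem
  have hinj : InjOn φ (x₀ +ᵥ (Λ k : Set V)) :=
    injOn_vadd_of_injOn_sub φ x₀ _ (injOn_of_linearNewton Λ φ₀ L hanti hbasis hNΛ)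
  have himg : ∀ j, k ≤ j → ∀ x ∈ Λ k, φ '' ((x₀ + x) +ᵥ (Λ j : Set V)) = φ (x₀ + x) +ᵥ (L : V → W) '' (Λ j : Set V) :=
    fun j hj x hx => image_vadd_eq_of_image_sub φ x₀ x _ L
      (image_vadd_eq_of_linearNewton Λ φ₀ L hanti hopen (hcomp k) hbasis hcont hNΛ hj hx)
  have hmap : (μ.restrict (Λ k : Set V)).map φ₀ = (μ.restrict (Λ k : Set V)).map L :=
    map_restrict_eq_map_restrict_of_linearNewton Λ φ₀ L μ hanti hopen (hcomp k) hbasis hcont hNΛ h0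
  have hlin : ∀ f : W → ℝ≥0∞, Measurable f → ∫⁻ v in (Λ k : Set V), f (φ (x₀ + v)) ∂μ = ∫⁻ v in (Λ k : Set V), f (φ x₀ + L v) ∂μ := by
    intro f hf
    have hΛk : MeasurableSet (Λ k : Set V) := (hopen k).measurableSet
    have hae : AEMeasurable φ₀ (μ.restrict (Λ k : Set V)) := hcont.aemeasurable hΛk
    have hg : Measurable fun w : W => f (φ x₀ + w) := hf.comp (measurable_const_add (φ x₀))
    have h1 : ∫⁻ v in (Λ k : Set V), f (φ (x₀ + v)) ∂μ = ∫⁻ w, f (φ x₀ + w) ∂((μ.restrict (Λ k : Set V)).map φ₀) := by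
      rw [lintegral_map' hg.aemeasurable hae]
      refine lintegral_congr fun v => ?_
      simp [hφ₀]
    have h2 : ∫⁻ w, f (φ x₀ + w) ∂((μ.restrict (Λ k : Set V)).map L) = ∫⁻ v in (Λ k : Set V), f (φ x₀ + L v) ∂μ :=
      lintegral_map hg L.continuous.measurable
    rw [h1, hmap, h2]
  exact ⟨hinj, himg, hmap, hlin⟩

end Core

/-! ## §2 Descent of Newton data to an additive subgroup -/

section Descent

variable {M : Type*} [SeminormedAddCommGroup M] {M' : Type*} [SeminormedAddCommGroup M']

/-- If `L` restricts to an equivalence `LS : S ≃ₜ+ S'` (same underlying values), then `L z ∈ S'` forces `z ∈ S`. [folklore] -/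
theorem mem_of_map_mem (S : AddSubgroup M) (S' : AddSubgroup M') (L : M ≃ₜ+ M') (LS : S ≃ₜ+ S') (hLS : ∀ s : S, (LS s : M') = L s)
    {z : M} (hz : L z ∈ S') : z ∈ S := by
  obtain ⟨s, hs⟩ := LS.surjective ⟨L z, hz⟩
  have h1 : L (s : M) = L z := by rw [← hLS s, hs]
  have : (s : M) = z := L.injective h1
  rw [← this]; exact s.2

/-- **DESCENT OF NEWTON DATA TO A SUBGROUP.**  Ambient data: for `k ≥ k₀`, `j ≥ k`, `‖x‖ ≤ rγᵏ`, `‖y‖ ≤ rγʲ` (in `M`),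
`φ (x₀ + (x + y)) − φ (x₀ + x) − L y ∈ L '' closedBall 0 (rγ^{j+1})`.  If `φ (x₀ + ·) − φ x₀` maps the additive subgroup `S` into `S'` and `L` restricts to `LS : S ≃ₜ+ S'`,
then the RESTRICTED map `φS : S → S'`, `φS s := ⟨φ (x₀ + s) − φ x₀, _⟩` (base point `0`) has the same data for `LS` in the subtype norms:
`φS (0 + (x + y)) − φS (0 + x) − LS y ∈ LS '' closedBall 0 (rγ^{j+1})`.  [cite: Serre1992LALG, Part II Ch. IV §9] -/
theorem newtonData_addSubgroup (S : AddSubgroup M) (S' : AddSubgroup M') (φ : M → M') (x₀ : M) (L : M ≃ₜ+ M') (LS : S ≃ₜ+ S')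
    (hLS : ∀ s : S, (LS s : M') = L s) (hφ : ∀ s : S, φ (x₀ + s) - φ x₀ ∈ S')
    {r γ : ℝ} {k₀ : ℕ}
    (hN : ∀ k, k₀ ≤ k → ∀ j, k ≤ j → ∀ x ∈ closedBall (0 : M) (r * γ ^ k), ∀ y ∈ closedBall (0 : M) (r * γ ^ j),
      φ (x₀ + (x + y)) - φ (x₀ + x) - L y ∈ (L : M → M') '' closedBall (0 : M) (r * γ ^ (j + 1))) :
    ∀ k, k₀ ≤ k → ∀ j, k ≤ j → ∀ x ∈ closedBall (0 : S) (r * γ ^ k), ∀ y ∈ closedBall (0 : S) (r * γ ^ j),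
      (fun s : S => (⟨φ (x₀ + s) - φ x₀, hφ s⟩ : S')) (0 + (x + y)) - (fun s : S => (⟨φ (x₀ + s) - φ x₀, hφ s⟩ : S')) (0 + x) - LS y ∈
        (LS : S → S') '' closedBall (0 : S) (r * γ ^ (j + 1)) := by
  intro k hk j hj x hx y hy
  have hx' : (x : M) ∈ closedBall (0 : M) (r * γ ^ k) := by
    simpa [mem_closedBall_zero_iff, AddSubgroup.coe_norm] using hx
  have hy' : (y : M) ∈ closedBall (0 : M) (r * γ ^ j) := by
    simpa [mem_closedBall_zero_iff, AddSubgroup.coe_norm] using hy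
  obtain ⟨z, hz, hzeq⟩ := hN k hk j hj x hx' y hy'
  -- `L z` is a difference of elements of `S'`, hence in `S'`, hence `z ∈ S`
  have hLz : L z ∈ S' := by
    rw [hzeq]
    have h1 : φ (x₀ + ((x : M) + y)) - φ x₀ ∈ S' := by simpa using hφ (x + y)
    have h2 : φ (x₀ + (x : M)) - φ x₀ ∈ S' := hφ x
    have h3 : L (y : M) ∈ S' := by rw [← hLS y]; exact (LS y).2
    have : φ (x₀ + ((x : M) + y)) - φ (x₀ + x) - L y = (φ (x₀ + ((x : M) + y)) - φ x₀) - (φ (x₀ + (x : M)) - φ x₀) - L y := by abel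
    rw [this]
    exact S'.sub_mem (S'.sub_mem h1 h2) h3
  have hzS : z ∈ S := mem_of_map_mem S S' L LS hLS hLz
  refine ⟨⟨z, hzS⟩, ?_, ?_⟩
  · simpa [mem_closedBall_zero_iff, AddSubgroup.coe_norm] using hz
  · apply Subtype.ext
    simp only [zero_add, AddSubgroup.coe_sub, hLS, hzeq, AddSubgroup.coe_add]
    abel

end Descent

end Summit.HodgeConjecture.HodgeConjecture.Cruxes.H413.F0P3cStCharTSNewtonCore

end
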